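import Literature.Computability.Cryptography.BLPRSReductionLeaves
import Literature.Computability.Cryptography.LWEPrimePowerMachine
import HarnessLib

/-!
# BLPRS 2013, Thm. 2.17 / Micciancio–Peikert 2012, Thm. 3.1 — the named leaf is a theorem of the tree

The named fact `BLPRS2013.searchLWE_to_decisionLWE_powTwo_smallDim q m`
(`BLPRSReductionLeaves.lean`: the decision-to-search machine for `LWE` in small dimension at a
power-of-two aggregation, hypothesis `h₂` of `blprs_gapSVP_sqrt_dim_to_lwe_classical_of_components`)
is, verbatim, the statement of the tree theorem `LWE.MP12.Machine.mp12_decision_to_search q m`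
(`LWEPrimePowerMachine.lean`, which builds the oracle machine and proves it without importing the
leaf file).  This leaf joins the two: the discharge under the tree's naming convention `X_holds`
(D-0026 bookkeeping — the proof term is the existing theorem; no statement, definition or attribute
is edited; no new named fact).  The ledger listed the fact as unproved (`ledger fact claim` GRANTED
«status unproved», 2026-08-28T10:1xZ).

## References
* [cite: BrakerskiEtAl2013, Thm. 2.17 and p. 13] — Brakerski, Langlois, Peikert, Regev, Stehlé,
  *Classical hardness of learning with errors*, STOC 2013.
* [cite: MicciancioPeikert2012, Thm. 3.1] — Micciancio, Peikert, *Trapdoors for lattices*,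
  EUROCRYPT 2012.
-/

namespace Literature.Computability.Cryptography.BLPRS2013

/- the section variables of `BLPRSReductionLeaves.lean` (modulus `q`, sample count `m`) -/
variable (q m : ℕ → ℕ)

/-- **BLPRS Thm. 2.17 / MP12 Thm. 3.1 (machine form, small dimension, power-of-two aggregation)
HOLDS** for all parameters `q`, `m`: the named leaf `searchLWE_to_decisionLWE_powTwo_smallDim q m`
is the tree theorem `LWE.MP12.Machine.mp12_decision_to_search q m`.
[cite: BrakerskiEtAl2013, Thm. 2.17 and p. 13] [cite: MicciancioPeikert2012, Thm. 3.1] -/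
theorem searchLWE_to_decisionLWE_powTwo_smallDim_holds :
    searchLWE_to_decisionLWE_powTwo_smallDim q m :=
  LWE.MP12.Machine.mp12_decision_to_search q m

end Literature.Computability.Cryptography.BLPRS2013
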